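import Literature.RepresentationTheory.MoeglinVignerasWaldspurger1987.RankOneThetaLiftNonPeriodicOfCharacter
import Literature.RepresentationTheory.MoeglinVignerasWaldspurger1987.RankOneTorusTrace
import Literature.RepresentationTheory.MoeglinVignerasWaldspurger1987.RankOneTorusBigCell
import Literature.RepresentationTheory.MoeglinVignerasWaldspurger1987.RankOneThetaLiftTwistRigidityOfNonPeriodicGlue
import HarnessLib

/-!
# Row IV-4(c3) `rankOne_theta_twist_rigidity` is a THEOREM: rank `1 × 1` non-periodicity holds (character route)

Topic `RepresentationTheory/MoeglinVignerasWaldspurger1987`; namespace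
`Literature.RepresentationTheory.MoeglinVignerasWaldspurger1987`.  THEOREMS ONLY (no definition, no named fact, no
`sorry`).  Cell `hodgecm-mathlib`, crux HD3 (`stmt-HodgeConjecture-24837`).  This leaf DISCHARGES the named fact
`rankOne_theta_twist_rigidity` (`RankOneThetaLiftTwistRigidity.lean`, row IV-4(c3) of the cell inventory; [MVW87, Chap. 3
IV.4]; [GelbartRogawski1991, §3]; [Liu2021, App. D Lem. D.1 (3)]) by composing, BY NAME, the pieces of the CHARACTER
ROUTE landed by the cell:

* (TR) the finite-level non-vanishing of the character of the `(U(1), U(1))` oscillator representation on Weil's big cell,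
  from the Schrödinger kernels: H1 `rankOne_torus_bigCell_package` (`RankOneTorusBigCell.lean`: the torus big-cell
  package) fed to H2 through `rankOne_torusTrace_ne_zero_of_bigCellPackage` (`RankOneTorusTrace.lean`, over
  `SchrodingerBigCellTrace`) — the junction of the cell's TR theorem `rankOne_torusTrace_ne_zero`, inlined here at the
  Haar measure `addHaar` and the conductor exponent of `ψ_v`;
* `nonPeriodic₁₁_of_torusTrace` (M4, `RankOneThetaLiftNonPeriodicOfCharacter.lean`: TR + multiplicity one (M1,
  `RankOneOscillatorMultiplicityOne`) + the finite-level trace identity (M2, `TwistedCoinvariantsTypePeriodicity`) ⇒ the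
  type set of the oscillator representation has no period, `hNP`);
* `rankOne_theta_twist_rigidity_of_nonPeriodic₁₁'` (route-R glue, `RankOneThetaLiftTwistRigidityOfNonPeriodicGlue.lean`:
  `hNP` ⇒ row IV-4(c3), over the wrapper `rankOne_theta_twist_rigidity_of_nonPeriodic₁₁`, the rational hyperbolic frame,
  the frame transport `twistRigid_of_frame` and the block rigidity `twistRigid_block`).

§1 `nonPeriodic₁₁_holds` — rank `1 × 1` non-periodicity, unconditionally; §2 `rankOne_theta_twist_rigidity_holds`.
Consumer: `Summit.HodgeConjecture.CorCM.HypD3.hD3_of_twistRigidity` (`HCCMUnconditionalHD3OfTwistRigidity.lean`) closes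
the binder `hD3`.  HC_CM is NOT proved here: HC_CM is proved only modulo the 7 printed citations until rung 0 of the
ladder closes.

## References
* [MoeglinVignerasWaldspurger1987] C. Mœglin, M.-F. Vignéras, J.-L. Waldspurger, LNM 1291 (1987), Chap. 2 II, Chap. 3 §IV.4.
* [GelbartRogawski1991] S. Gelbart, J. Rogawski, Invent. Math. 105 (1991), §3 pp. 455–462.
* [Howe1973] R. Howe, On the character of Weil's representation, Trans. AMS 177 (1973) 287–298.
* [Liu2021] Y. Liu, Camb. J. Math. 9 (2021), App. D Lem. D.1 (3).
-/

set_option autoImplicit false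

noncomputable section

open NumberField IsDedekindDomain Matrix MeasureTheory
open scoped Matrix MatrixGroups
open Literature.RepresentationTheory Literature.RepresentationTheory.HeisenbergGroup
open Literature.NumberTheory.GelbartRogawski1991.UnitaryDualPair.LocalSplitting
open Literature.NumberTheory.GelbartRogawski1991.UnitaryDualPair.LocalSplitting.BlockSum
open Literature.NumberTheory.Automorphic Literature.NumberTheory.Automorphic.UnitaryGroup
open Literature.NumberTheory.Automorphic.Liu2021

namespace Literature.RepresentationTheory.MoeglinVignerasWaldspurger1987

/-! ## §1 Rank `1 × 1` non-periodicity holds -/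

-- thirty-binder statement: about 4× the default elaboration budget
set_option maxHeartbeats 1600000 in
/-- **RANK `1 × 1` NON-PERIODICITY (the wall `hNP` of route R), UNCONDITIONALLY**: for a `1 × 1` Gram matrix `t`, a
non-split place `v`, a section `s₁` of `U(J₁)(F_v)` into `S̃p(𝕎_v)` over `ι_v` with `ω_{s₁}` smooth and a character `η₁`
of `U(J₁)(F_v) = E_v¹` with open kernel: if the type set `{ξ : Coinv_ξ(ω_{s₁}) ≠ 0}` of the `(U(1), U(1))` oscillator
representation is invariant under `ξ ↦ ξ · η₁`, then `η₁ = 1` — `nonPeriodic₁₁_of_torusTrace` fed with the finite-level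
character non-vanishing (H1 `rankOne_torus_bigCell_package` through the H2 junction `rankOne_torusTrace_ne_zero_of_bigCellPackage`). [cite: MoeglinVignerasWaldspurger1987, Chap. 2 II.8 and Chap. 3 §IV.4 Théorème principal 1) a)]
[cite: Howe1973, Theorem] -/
theorem nonPeriodic₁₁_holds :
    ∀ (F : Type) [Field F] [NumberField F] (E : Type) [Field E] [NumberField E] [Algebra F E]
      [Algebra.IsQuadraticExtension F E] (c : E ≃ₐ[F] E) (δ : E) (hcδ : c δ = -δ) (hδ : δ ≠ 0) (d : F)
      (hd : δ * δ = algebraMap F E d) (t : Matrix (Fin 1) (Fin 1) F) (ht : t.IsSymm) (_htd : IsUnit t.det)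
      (J₁ : Matrix (Fin 1) (Fin 1) E) (hJ₁ : J₁ = t.map (algebraMap F E)) (v : HeightOneSpectrum (𝓞 F))
      (_hE : IsField (UnitaryGroup.LocalRing E v))
      (s₁ : localPi E c 1 J₁ v →* LocalMp F 1 t v)
      (_hs₁ : ∀ g, MpPsi.proj _ (s₁ g) = iota F E c 1 hcδ hδ hd t ht hJ₁ v g)
      (_hsm₁ : Representation.IsSmooth ((MpPsi.toRep (localSchrodinger F 1 t v)).comp s₁))
      (η₁ : localPi E c 1 J₁ v →* ℂˣ)
      (_hη₁ : IsOpen ((η₁.ker : Subgroup (localPi E c 1 J₁ v)) : Set (localPi E c 1 J₁ v))),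
      (∀ (ξ : localPi E c 1 J₁ v →* ℂˣ), (∀ u, ‖((ξ u : ℂˣ) : ℂ)‖ = 1) → (Continuous fun u => ((ξ u : ℂˣ) : ℂ)) →
        (Nontrivial (TwistedCoinv.Coinv ((MpPsi.toRep (localSchrodinger F 1 t v)).comp s₁) ξ) ↔
          Nontrivial (TwistedCoinv.Coinv ((MpPsi.toRep (localSchrodinger F 1 t v)).comp s₁) (ξ * η₁)))) →
      η₁ = 1 :=
  nonPeriodic₁₁_of_torusTrace fun F _ _ E _ _ _ _ c δ hcδ hδ d hd t ht htd J₁ hJ₁ v hE s₁ hs₁ hsm₁ z₀ hz₀ => by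
    -- the TR junction (B-p04, `RankOneTorusTrace`): H1 `rankOne_torus_bigCell_package` fed to H2 at Haar measure
    -- `addHaar` and the conductor exponent of `ψ_v`
    letI : MeasurableSpace (v.adicCompletion F) := borel _
    haveI : BorelSpace (v.adicCompletion F) := ⟨rfl⟩
    obtain ⟨m, hm⟩ := (isContinuousNontrivial_adeleAddCharAt F v).exists_hasConductorExp
    exact rankOne_torusTrace_ne_zero_of_bigCellPackage F E c δ hcδ hδ t htd J₁ hJ₁ v hE s₁ hsm₁ z₀
      MeasureTheory.Measure.addHaar m hm
      (rankOne_torus_bigCell_package F E c δ hcδ hδ d hd t ht htd J₁ hJ₁ v hE s₁ hs₁ hsm₁ z₀ hz₀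
        MeasureTheory.Measure.addHaar m hm)

/-! ## §2 Row IV-4(c3) holds -/

/-- **ROW IV-4(c3) `rankOne_theta_twist_rigidity` IS A THEOREM**: at a non-split place `v`, two splittings
`s₁, s₂ : U(J)(F_v) →* S̃p(𝕎_v)` over `ι_v` (`J = T ⊗ 1` of rank `3`, `ω_{sᵢ}` smooth) whose rank-one theta lifts
`Θ_{s₁}(χ₁) ≅ Θ_{s₂}(χ₂)` are isomorphic and non-zero are EQUAL — the route-R glue
`rankOne_theta_twist_rigidity_of_nonPeriodic₁₁'` at `hNP := nonPeriodic₁₁_holds`.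
[cite: MoeglinVignerasWaldspurger1987, Chap. 3 IV.4 and Chap. 2 II.1 Rem. (6), II Remarque (3)]
[cite: GelbartRogawski1991, §3 pp. 461–462] [cite: Liu2021, App. D Lemma D.1 (3)] -/
theorem rankOne_theta_twist_rigidity_holds : rankOne_theta_twist_rigidity :=
  rankOne_theta_twist_rigidity_of_nonPeriodic₁₁' nonPeriodic₁₁_holds

end Literature.RepresentationTheory.MoeglinVignerasWaldspurger1987

end
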